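import Summits.Ventures.CertifiedManyBodySolver.Transport.PauliMarkovMatrix
import HarnessLib

/-!
# Ventures/CertifiedManyBodySolver — Transport/PauliMarkovMatrixRows.lean

HONEST FRAMING: first certified bounds; not a superconductivity verdict; every number certified or labelled float.

Row forms of LEMMA PMP (`Transport/PauliMarkovMatrix.lean`,
`InfVolFermionState.IsTranslationInvariant.pauliMarkovMatrix`) for the cell's certificates
(op-02 `HOME/op/PM-2D.md` §2, §4, §7.3–7.5):

* §1 characters as cosines: `Re χ_{−r}(k) = cos(k·r)`, `k·r = Σ_i r_i k_i` (`siteDot`, `re_boxChar_neg`);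
* §2 **LEMMA PM-ℤ^d (the scalar corner; op-02's Lemma PM-2D for `d = 2`)**: for every
  translation-invariant `ω : InfVolFermionState d`, spin `σ`, finite `S ⊂ ℤ^d` and real `λ : S → ℝ`,
  `Σ_{r∈S} λ_r Re ω(c†_{0σ} c_{rσ}) ≤ PM_{ℤ^d}(λ) := (2π)^{-d} ∫_{(0,2π]^d} max(p_λ(k), 0) dk`,
  `p_λ(k) = Σ_{r∈S} λ_r cos(k·r)` (`pmSymbolZd`, `pmValueZd`,
  `InfVolFermionState.IsTranslationInvariant.pauliMarkovZd`) — the `1 × 1` corner `Λ_r = λ_r E₀₀` of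
  Lemma PMP with the majorant `u = (p_λ)_+` (a feasible `M` has `M₀₀ ∈ [0, 1]`); g28's
  `IsTranslationInvariant.pauliMarkov` (`Transport/PauliMarkov.lean`) is the one-direction case `S ⊂ ℤv`;
* §3 the OPERATOR FORM of the PMP row on a region `Λ ∋ 0`, `Λ ⊇ S`:
  `O_Λ = Σ_{r∈S} Σ_{j,l} (Λ_r)_{lj} A_j(0)† A_l(r)` (`pmpOp`), `ω(O_Λ) = Σ_{r∈S} tr(Λ_r G_ω(r))`
  (`expect_pmpOp`), `Re ω(O_Λ) ≤ (2π)^{-d} ∫ u` for every majorant `u` of `Re tr(Λ̂(k) ·)` on the body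
  `0 ⪯ M ⪯ C(ν)` (`re_expect_pmpOp_le`), isotony (`fermionEmbed_incl_pmpOp`), and the certificate SLACK
  FORMS `re_expect_pmpSlack_nonneg` / `re_expect_sub_pmpSlack_le` (rows `(σ_i, τ_i, S_i, Λ^{(i)})` with
  multipliers `κ_i ≥ 0` and certified rhs bounds `(2π)^{-d} ∫ u_i ≤ B_i` moved into the objective, exactly
  as `Transport/PauliMarkov.lean` does for the chain PM rows);
* §4 the same for the scalar corner (`pmOpZd`, `re_expect_pmOpZd_le`, `fermionEmbed_incl_pmOpZd`,
  `re_expect_pmZdSlack_nonneg`, `re_expect_sub_pmZdSlack_le`).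

ADMISSIBILITY (PM-2D.md §4): in `d = 2` these rows are constraints valid for every translation-invariant
state, hence admissible in a lower bound for Ruelle's `e_2D` by
`InfVolFermionState.isLeast_hubbardEnergyDensity_energyDensity2D` with no torus pull-back; the rhs
`B_i` is the reader's validated-quadrature / Arb leg (hypothesis `hB`), not a Lean computation.

No physical notion is defined (abbreviations only), no named fact, no sorry; axioms standard.

References: op-02 PM-2D.md §2 (Lemma PM-2D), §7.4 (PMP), §7.3/§7.5.2 (row grammar);
E. H. Lieb, R. Seiringer, *The Stability of Matter in Quantum Mechanics* (CUP 2010) Thm. 3.2.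
-/

noncomputable section

namespace Summit.Ventures.CertifiedManyBodySolver.Transport

open Matrix Finset MeasureTheory
open Literature.Probability.LatticeModels
open Literature.MathematicalPhysics.QuantumLattice HubbardWave0
open scoped ComplexOrder Real

variable {d : ℕ}

/-! ### §1. Characters as cosines -/

/-- `k·m = Σ_i m_i k_i`. -/
def siteDot (m : Site d) (k : Fin d → ℝ) : ℝ := ∑ i, ((m i : ℤ) : ℝ) * k i

/-- `k·(−m) = −k·m`. -/
theorem siteDot_neg (m : Site d) (k : Fin d → ℝ) : siteDot (-m) k = -siteDot m k := by
  simp only [siteDot, Pi.neg_apply, Int.cast_neg, neg_mul, Finset.sum_neg_distrib]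

/-- `k·m` is continuous in `k`. -/
theorem continuous_siteDot (m : Site d) : Continuous (siteDot m) := by
  unfold siteDot
  fun_prop

/-- `χ_m(k) = e^{i k·m}`. -/
theorem boxChar_eq_exp (m : Site d) (k : Fin d → ℝ) :
    boxChar m k = Complex.exp (((siteDot m k : ℝ) : ℂ) * Complex.I) := by
  rw [boxChar, ← Complex.exp_sum, siteDot]
  congr 1
  push_cast
  rw [Finset.sum_mul]
  refine Finset.sum_congr rfl fun i _ => ?_
  ring

/-- `Re χ_m(k) = cos(k·m)`. -/
theorem re_boxChar (m : Site d) (k : Fin d → ℝ) : (boxChar m k).re = Real.cos (siteDot m k) := by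
  rw [boxChar_eq_exp, Complex.exp_ofReal_mul_I_re]

/-- `Im χ_m(k) = sin(k·m)`. -/
theorem im_boxChar (m : Site d) (k : Fin d → ℝ) : (boxChar m k).im = Real.sin (siteDot m k) := by
  rw [boxChar_eq_exp, Complex.exp_ofReal_mul_I_im]

/-- `Re χ_{−m}(k) = cos(k·m)`. -/
theorem re_boxChar_neg (m : Site d) (k : Fin d → ℝ) : (boxChar (-m) k).re = Real.cos (siteDot m k) := by
  rw [re_boxChar, siteDot_neg, Real.cos_neg]

/-! ### §2. LEMMA PM-ℤ^d: the scalar corner -/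

section Scalar

/-- **The scalar symbol** `p_λ(k) = Σ_{r∈S} λ_r cos(k·r)` of a real coefficient family `λ` on `S ⊂ ℤ^d`. -/
def pmSymbolZd (S : Finset (Site d)) (lam : Site d → ℝ) (k : Fin d → ℝ) : ℝ :=
  ∑ r ∈ S, lam r * Real.cos (siteDot r k)

/-- **The Pauli–Markov value** `PM_{ℤ^d}(λ) = (2π)^{-d} ∫_{(0,2π]^d} max(p_λ(k), 0) dk`
(op-02's `h(λ) = ∫_{T^d} (p_λ)_+ d^dk/(2π)^d`; an exact Lebesgue integral — no numerics). -/
def pmValueZd (S : Finset (Site d)) (lam : Site d → ℝ) : ℝ :=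
  ((2 * π) ^ d)⁻¹ * ∫ k in torusBox d, max (pmSymbolZd S lam k) 0

/-- `p_λ` is continuous. -/
theorem continuous_pmSymbolZd (S : Finset (Site d)) (lam : Site d → ℝ) : Continuous (pmSymbolZd S lam) := by
  unfold pmSymbolZd
  exact continuous_finsetSum _ fun r _ => continuous_const.mul (Real.continuous_cos.comp (continuous_siteDot r))

/-- `(p_λ)_+` is integrable on the box. -/
theorem integrableOn_pmSymbolZd_posPart (S : Finset (Site d)) (lam : Site d → ℝ) :
    IntegrableOn (fun k => max (pmSymbolZd S lam k) 0) (torusBox d) :=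
  integrableOn_torusBox_of_continuous ((continuous_pmSymbolZd S lam).max continuous_const)

/-- The corner coefficient family `Λ_r = λ_r E₀₀`. -/
def cornerCoeff (lam : Site d → ℝ) (r : Site d) : Matrix (Fin 2) (Fin 2) ℂ := !![((lam r : ℝ) : ℂ), 0; 0, 0]

/-- `tr(λ_r E₀₀ G) = λ_r G₀₀`. -/
theorem trace_cornerCoeff_mul (lam : Site d → ℝ) (r : Site d) (G : Matrix (Fin 2) (Fin 2) ℂ) :
    (cornerCoeff lam r * G).trace = ((lam r : ℝ) : ℂ) * G 0 0 := by
  rw [Matrix.trace_fin_two, Matrix.mul_apply, Matrix.mul_apply]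
  simp [cornerCoeff, Fin.sum_univ_two]

/-- `tr(Λ̂(k) M) = (Σ_r χ_{−r}(k) λ_r) M₀₀` for the corner family. -/
theorem trace_matrixSymbol_cornerCoeff_mul (S : Finset (Site d)) (lam : Site d → ℝ) (k : Fin d → ℝ)
    (M : Matrix (Fin 2) (Fin 2) ℂ) :
    (matrixSymbol S (cornerCoeff lam) k * M).trace = (∑ r ∈ S, boxChar (-r) k * ((lam r : ℝ) : ℂ)) * M 0 0 := by
  rw [matrixSymbol, Finset.sum_mul, Matrix.trace_sum, Finset.sum_mul]
  refine Finset.sum_congr rfl fun r _ => ?_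
  rw [Matrix.smul_mul, Matrix.trace_smul, trace_cornerCoeff_mul, smul_eq_mul, mul_assoc]

/-- `Re tr(Λ̂(k) M) = p_λ(k) Re M₀₀` for the corner family when `M₀₀` is real. -/
theorem re_trace_matrixSymbol_cornerCoeff_mul (S : Finset (Site d)) (lam : Site d → ℝ) (k : Fin d → ℝ)
    (M : Matrix (Fin 2) (Fin 2) ℂ) (hM : (M 0 0).im = 0) :
    ((matrixSymbol S (cornerCoeff lam) k * M).trace).re = pmSymbolZd S lam k * (M 0 0).re := by
  rw [trace_matrixSymbol_cornerCoeff_mul, Complex.mul_re, hM, mul_zero, sub_zero, Complex.re_sum, pmSymbolZd]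
  congr 1
  refine Finset.sum_congr rfl fun r _ => ?_
  rw [Complex.mul_re, Complex.ofReal_re, Complex.ofReal_im, mul_zero, sub_zero, re_boxChar_neg, mul_comm]

/-- The opposite spin. -/
def otherSpin (σ : Fin 2) : Fin 2 := if σ = 0 then 1 else 0

/-- `σ ≠ σ̄`. -/
theorem ne_otherSpin (σ : Fin 2) : σ ≠ otherSpin σ := by
  unfold otherSpin
  fin_cases σ <;> decide

/-- Pointwise: `p m ≤ max(p, 0)` for `m ∈ [0, 1]`. -/
theorem mul_le_max_of_mem_Icc (p m : ℝ) (h0 : 0 ≤ m) (h1 : m ≤ 1) : p * m ≤ max p 0 := by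
  rcases le_or_gt 0 p with hp | hp
  · exact (mul_le_of_le_one_right hp h1).trans (le_max_left _ _)
  · exact (mul_nonpos_iff.2 (Or.inr ⟨hp.le, h0⟩)).trans (le_max_right _ _)

variable (ω : InfVolFermionState d) (σ : Fin 2)

/-- **LEMMA PM-ℤ^d (scalar Pauli–Markov body on `ℤ^d`; op-02 PM-2D.md §2 for `d = 2`).** For a
translation-invariant infinite-volume lattice fermion state `ω`, a spin `σ`, a finite `S ⊂ ℤ^d` and real
coefficients `λ`: `Σ_{r∈S} λ_r Re ω(c†_{0σ} c_{rσ}) ≤ (2π)^{-d} ∫_{(0,2π]^d} max(Σ_{r∈S} λ_r cos(k·r), 0) dk`.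
(The `E₀₀` corner of Lemma PMP; inputs: state positivity, CAR, translation invariance — no quasi-free
hypothesis, no Herglotz–Bochner.) -/
theorem _root_.Literature.MathematicalPhysics.QuantumLattice.InfVolFermionState.IsTranslationInvariant.pauliMarkovZd
    (hω : ω.IsTranslationInvariant) (S : Finset (Site d)) (lam : Site d → ℝ) :
    ∑ r ∈ S, lam r * (ω.twoPoint σ 0 r).re ≤ pmValueZd S lam := by
  have h := hω.pauliMarkovMatrix ω σ (otherSpin σ) (ne_otherSpin σ) S (cornerCoeff lam)
    (fun k => max (pmSymbolZd S lam k) 0) (integrableOn_pmSymbolZd_posPart S lam) (fun k _ M hM => by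
      obtain ⟨him, h0, h1⟩ := hM.apply_zero_zero
      rw [re_trace_matrixSymbol_cornerCoeff_mul S lam k M him]
      exact mul_le_max_of_mem_Icc _ _ h0 h1)
  have hl : ∀ r ∈ S, ((cornerCoeff lam r * letterTwoPoint ω σ (otherSpin σ) r).trace).re =
      lam r * (ω.twoPoint σ 0 r).re := by
    intro r _
    rw [trace_cornerCoeff_mul, letterTwoPoint_zero_zero, Complex.re_ofReal_mul]
  rw [Finset.sum_congr rfl hl] at h
  exact h

/-- The same with the two-point function at a general base point: `Σ_{r∈S} λ_r Re ω(c†_{xσ} c_{x+r,σ}) ≤ PM_{ℤ^d}(λ)`. -/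
theorem _root_.Literature.MathematicalPhysics.QuantumLattice.InfVolFermionState.IsTranslationInvariant.pauliMarkovZd'
    (hω : ω.IsTranslationInvariant) (S : Finset (Site d)) (lam : Site d → ℝ) (x : Site d) :
    ∑ r ∈ S, lam r * (ω.twoPoint σ x (x + r)).re ≤ pmValueZd S lam := by
  have h := hω.pauliMarkovZd ω σ S lam
  have hx : ∀ r ∈ S, ω.twoPoint σ x (x + r) = ω.twoPoint σ 0 r := fun r _ => by
    rw [hω.twoPoint_eq_zero_sub ω σ x (x + r), add_sub_cancel_left]
  rw [Finset.sum_congr rfl fun r hr => by rw [hx r hr]]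
  exact h

end Scalar

/-! ### §3. Operator and slack forms of the PMP row -/

section Operator

variable (ω : InfVolFermionState d) (σ τ : Fin 2)

/-- **The PMP row operator** `O_Λ = Σ_{r∈S} Σ_{j,l} (Λ_r)_{lj} A_j(0)† A_l(r)` in a region `Λ` containing
`0` and `S` (memberships supplied by the caller). -/
def pmpOp (S : Finset (Site d)) (Lam : Site d → Matrix (Fin 2) (Fin 2) ℂ) (σ τ : Fin 2) (Λ : Finset (Site d))
    (h0 : (0 : Site d) ∈ Λ) (hmem : ∀ r ∈ S, r ∈ Λ) : FermionOp Λ :=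
  ∑ r ∈ S.attach, ∑ j : Fin 2, ∑ l : Fin 2,
    Lam r l j • ((letterOp j 0 h0 σ τ)ᴴ * letterOp l r (hmem r r.2) σ τ)

/-- **`ω(O_Λ) = Σ_{r∈S} tr(Λ_r G_ω(r))`.** -/
theorem expect_pmpOp (S : Finset (Site d)) (Lam : Site d → Matrix (Fin 2) (Fin 2) ℂ) (Λ : Finset (Site d))
    (h0 : (0 : Site d) ∈ Λ) (hmem : ∀ r ∈ S, r ∈ Λ) :
    ω.expect Λ (pmpOp S Lam σ τ Λ h0 hmem) = ∑ r ∈ S, (Lam r * letterTwoPoint ω σ τ r).trace := by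
  rw [pmpOp, map_sum, ← Finset.sum_attach S (fun r => (Lam r * letterTwoPoint ω σ τ r).trace)]
  refine Finset.sum_congr rfl fun r _ => ?_
  simp_rw [map_sum]
  rw [Matrix.trace, Finset.sum_comm]
  refine Finset.sum_congr rfl fun l _ => ?_
  rw [Matrix.diag_apply, Matrix.mul_apply]
  refine Finset.sum_congr rfl fun j _ => ?_
  rw [map_smul, smul_eq_mul, letterTwoPoint_eq_expect ω σ τ r j l h0 (hmem r r.2)]

/-- **LEMMA PMP (operator form).** For translation-invariant `ω`, `σ ≠ τ`, any region `Λ ∋ 0`, `Λ ⊇ S`, and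
any majorant `u` of `Re tr(Λ̂(k) ·)` on the body `0 ⪯ M ⪯ C(ν)`, `ν = ω(n_{0τ})`:
`Re ω(O_Λ) ≤ (2π)^{-d} ∫_{(0,2π]^d} u`. -/
theorem re_expect_pmpOp_le (hω : ω.IsTranslationInvariant) (hστ : σ ≠ τ) (S : Finset (Site d))
    (Lam : Site d → Matrix (Fin 2) (Fin 2) ℂ) (u : (Fin d → ℝ) → ℝ) (hu : IntegrableOn u (torusBox d))
    (hmaj : ∀ k ∈ torusBox d, ∀ M : Matrix (Fin 2) (Fin 2) ℂ, PMPFeasible (spinDensity ω τ) M →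
      ((matrixSymbol S Lam k * M).trace).re ≤ u k)
    (Λ : Finset (Site d)) (h0 : (0 : Site d) ∈ Λ) (hmem : ∀ r ∈ S, r ∈ Λ) :
    (ω.expect Λ (pmpOp S Lam σ τ Λ h0 hmem)).re ≤ ((2 * π) ^ d)⁻¹ * ∫ k in torusBox d, u k := by
  rw [expect_pmpOp, Complex.re_sum]
  exact hω.pauliMarkovMatrix ω σ τ hστ S Lam u hu hmaj

/-- Isotony: embedding `O_Λ` into a larger region gives `O_Λ` there. -/
theorem fermionEmbed_incl_pmpOp (S : Finset (Site d)) (Lam : Site d → Matrix (Fin 2) (Fin 2) ℂ)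
    {Λ Λ' : Finset (Site d)} (h : Λ ⊆ Λ') (h0 : (0 : Site d) ∈ Λ) (hmem : ∀ r ∈ S, r ∈ Λ) :
    fermionEmbed (PolySite.incl h) (pmpOp S Lam σ τ Λ h0 hmem) =
      pmpOp S Lam σ τ Λ' (h h0) (fun r hr => h (hmem r hr)) := by
  simp only [pmpOp, map_sum, map_smul, map_mul, fermionEmbed_conjTranspose, fermionEmbed_incl_letterOp]

/-- **Slack form for certificates.** For PMP rows `(σ_i, τ_i, S_i, Λ^{(i)})`, `σ_i ≠ τ_i`, with majorants
`u_i`, multipliers `κ_i ≥ 0` and certified rhs bounds `(2π)^{-d} ∫ u_i ≤ B_i`, the dualised slack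
`Σ_i κ_i (B_i 𝟙 − O_{Λ^{(i)}})` has nonnegative real expectation in every translation-invariant state. -/
theorem re_expect_pmpSlack_nonneg (hω : ω.IsTranslationInvariant) {Λ : Finset (Site d)} (h0 : (0 : Site d) ∈ Λ)
    {ι : Type*} (s : Finset ι) (σ τ : ι → Fin 2) (hστ : ∀ i ∈ s, σ i ≠ τ i) (S : ι → Finset (Site d))
    (Lam : ι → Site d → Matrix (Fin 2) (Fin 2) ℂ) (hmem : ∀ i, ∀ r ∈ S i, r ∈ Λ)
    (u : ι → (Fin d → ℝ) → ℝ) (hu : ∀ i ∈ s, IntegrableOn (u i) (torusBox d))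
    (hmaj : ∀ i ∈ s, ∀ k ∈ torusBox d, ∀ M : Matrix (Fin 2) (Fin 2) ℂ, PMPFeasible (spinDensity ω (τ i)) M →
      ((matrixSymbol (S i) (Lam i) k * M).trace).re ≤ u i k)
    (κ B : ι → ℝ) (hκ : ∀ i ∈ s, 0 ≤ κ i) (hB : ∀ i ∈ s, ((2 * π) ^ d)⁻¹ * ∫ k in torusBox d, u i k ≤ B i) :
    0 ≤ (ω.expect Λ (∑ i ∈ s, ((κ i : ℝ) : ℂ) •
      (((B i : ℝ) : ℂ) • (1 : FermionOp Λ) - pmpOp (S i) (Lam i) (σ i) (τ i) Λ h0 (hmem i)))).re := by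
  rw [map_sum, Complex.re_sum]
  refine Finset.sum_nonneg fun i hi => ?_
  rw [map_smul, smul_eq_mul, Complex.re_ofReal_mul, map_sub, map_smul, ω.expect_one, smul_eq_mul, mul_one,
    Complex.sub_re, Complex.ofReal_re]
  refine mul_nonneg (hκ i hi) (sub_nonneg.2 ?_)
  exact (re_expect_pmpOp_le ω (σ i) (τ i) hω (hστ i hi) (S i) (Lam i) (u i) (hu i hi) (hmaj i hi) Λ h0
    (hmem i)).trans (hB i hi)

/-- The same in difference form: `Re ω(X − Σ_i κ_i (B_i 𝟙 − O_{Λ^{(i)}})) ≤ Re ω(X)`. -/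
theorem re_expect_sub_pmpSlack_le (hω : ω.IsTranslationInvariant) {Λ : Finset (Site d)} (h0 : (0 : Site d) ∈ Λ)
    {ι : Type*} (s : Finset ι) (σ τ : ι → Fin 2) (hστ : ∀ i ∈ s, σ i ≠ τ i) (S : ι → Finset (Site d))
    (Lam : ι → Site d → Matrix (Fin 2) (Fin 2) ℂ) (hmem : ∀ i, ∀ r ∈ S i, r ∈ Λ)
    (u : ι → (Fin d → ℝ) → ℝ) (hu : ∀ i ∈ s, IntegrableOn (u i) (torusBox d))
    (hmaj : ∀ i ∈ s, ∀ k ∈ torusBox d, ∀ M : Matrix (Fin 2) (Fin 2) ℂ, PMPFeasible (spinDensity ω (τ i)) M →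
      ((matrixSymbol (S i) (Lam i) k * M).trace).re ≤ u i k)
    (κ B : ι → ℝ) (hκ : ∀ i ∈ s, 0 ≤ κ i) (hB : ∀ i ∈ s, ((2 * π) ^ d)⁻¹ * ∫ k in torusBox d, u i k ≤ B i)
    (X : FermionOp Λ) :
    (ω.expect Λ (X - ∑ i ∈ s, ((κ i : ℝ) : ℂ) •
      (((B i : ℝ) : ℂ) • (1 : FermionOp Λ) - pmpOp (S i) (Lam i) (σ i) (τ i) Λ h0 (hmem i)))).re ≤
      (ω.expect Λ X).re := by
  rw [map_sub, Complex.sub_re]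
  linarith [re_expect_pmpSlack_nonneg ω hω h0 s σ τ hστ S Lam hmem u hu hmaj κ B hκ hB]

end Operator

/-! ### §4. Operator and slack forms of the scalar corner -/

section ScalarOperator

variable (ω : InfVolFermionState d) (σ : Fin 2)

/-- **The scalar PM-ℤ^d row operator** `O_λ = Σ_{r∈S} λ_r c†_{0σ} c_{rσ}` in a region `Λ ∋ 0`, `Λ ⊇ S`. -/
def pmOpZd (S : Finset (Site d)) (lam : Site d → ℝ) (σ : Fin 2) (Λ : Finset (Site d)) (h0 : (0 : Site d) ∈ Λ)
    (hmem : ∀ r ∈ S, r ∈ Λ) : FermionOp Λ :=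
  ∑ r ∈ S.attach, ((lam r : ℝ) : ℂ) • ((cAt 0 h0 σ)ᴴ * cAt r (hmem r r.2) σ)

/-- `ω(O_λ) = Σ_{r∈S} λ_r ω(c†_{0σ} c_{rσ})`. -/
theorem expect_pmOpZd (S : Finset (Site d)) (lam : Site d → ℝ) (Λ : Finset (Site d)) (h0 : (0 : Site d) ∈ Λ)
    (hmem : ∀ r ∈ S, r ∈ Λ) :
    ω.expect Λ (pmOpZd S lam σ Λ h0 hmem) = ∑ r ∈ S, ((lam r : ℝ) : ℂ) * ω.twoPoint σ 0 r := by
  rw [pmOpZd, map_sum, ← Finset.sum_attach S (fun r => ((lam r : ℝ) : ℂ) * ω.twoPoint σ 0 r)]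
  refine Finset.sum_congr rfl fun r _ => ?_
  rw [map_smul, smul_eq_mul, ω.expect_creation_mul_annihilation]

/-- **LEMMA PM-ℤ^d (operator form)**: `Re ω(O_λ) ≤ PM_{ℤ^d}(λ)` on any region `Λ ∋ 0`, `Λ ⊇ S`. -/
theorem re_expect_pmOpZd_le (hω : ω.IsTranslationInvariant) (S : Finset (Site d)) (lam : Site d → ℝ)
    (Λ : Finset (Site d)) (h0 : (0 : Site d) ∈ Λ) (hmem : ∀ r ∈ S, r ∈ Λ) :
    (ω.expect Λ (pmOpZd S lam σ Λ h0 hmem)).re ≤ pmValueZd S lam := by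
  rw [expect_pmOpZd, Complex.re_sum]
  simp_rw [Complex.re_ofReal_mul]
  exact hω.pauliMarkovZd ω σ S lam

/-- Isotony: embedding `O_λ` into a larger region gives `O_λ` there. -/
theorem fermionEmbed_incl_pmOpZd (S : Finset (Site d)) (lam : Site d → ℝ) {Λ Λ' : Finset (Site d)} (h : Λ ⊆ Λ')
    (h0 : (0 : Site d) ∈ Λ) (hmem : ∀ r ∈ S, r ∈ Λ) :
    fermionEmbed (PolySite.incl h) (pmOpZd S lam σ Λ h0 hmem) = pmOpZd S lam σ Λ' (h h0) (fun r hr => h (hmem r hr)) := by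
  simp only [pmOpZd, map_sum, map_smul, map_mul, fermionEmbed_conjTranspose, fermionEmbed_incl_cAt]

/-- **Slack form for certificates** (scalar rows `(σ_i, S_i, λ^{(i)})`, `κ_i ≥ 0`, `PM_{ℤ^d}(λ^{(i)}) ≤ B_i`):
`0 ≤ Re ω(Σ_i κ_i (B_i 𝟙 − O_{λ^{(i)}}))` in every translation-invariant state. -/
theorem re_expect_pmZdSlack_nonneg (hω : ω.IsTranslationInvariant) {Λ : Finset (Site d)} (h0 : (0 : Site d) ∈ Λ)
    {ι : Type*} (s : Finset ι) (σ : ι → Fin 2) (S : ι → Finset (Site d)) (lam : ι → Site d → ℝ)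
    (hmem : ∀ i, ∀ r ∈ S i, r ∈ Λ) (κ B : ι → ℝ) (hκ : ∀ i ∈ s, 0 ≤ κ i)
    (hB : ∀ i ∈ s, pmValueZd (S i) (lam i) ≤ B i) :
    0 ≤ (ω.expect Λ (∑ i ∈ s, ((κ i : ℝ) : ℂ) •
      (((B i : ℝ) : ℂ) • (1 : FermionOp Λ) - pmOpZd (S i) (lam i) (σ i) Λ h0 (hmem i)))).re := by
  rw [map_sum, Complex.re_sum]
  refine Finset.sum_nonneg fun i hi => ?_
  rw [map_smul, smul_eq_mul, Complex.re_ofReal_mul, map_sub, map_smul, ω.expect_one, smul_eq_mul, mul_one,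
    Complex.sub_re, Complex.ofReal_re]
  refine mul_nonneg (hκ i hi) (sub_nonneg.2 ?_)
  exact (re_expect_pmOpZd_le ω (σ i) hω (S i) (lam i) Λ h0 (hmem i)).trans (hB i hi)

/-- The same in difference form: `Re ω(X − Σ_i κ_i (B_i 𝟙 − O_{λ^{(i)}})) ≤ Re ω(X)`. -/
theorem re_expect_sub_pmZdSlack_le (hω : ω.IsTranslationInvariant) {Λ : Finset (Site d)} (h0 : (0 : Site d) ∈ Λ)
    {ι : Type*} (s : Finset ι) (σ : ι → Fin 2) (S : ι → Finset (Site d)) (lam : ι → Site d → ℝ)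
    (hmem : ∀ i, ∀ r ∈ S i, r ∈ Λ) (κ B : ι → ℝ) (hκ : ∀ i ∈ s, 0 ≤ κ i)
    (hB : ∀ i ∈ s, pmValueZd (S i) (lam i) ≤ B i) (X : FermionOp Λ) :
    (ω.expect Λ (X - ∑ i ∈ s, ((κ i : ℝ) : ℂ) •
      (((B i : ℝ) : ℂ) • (1 : FermionOp Λ) - pmOpZd (S i) (lam i) (σ i) Λ h0 (hmem i)))).re ≤
      (ω.expect Λ X).re := by
  rw [map_sub, Complex.sub_re]
  linarith [re_expect_pmZdSlack_nonneg ω hω h0 s σ S lam hmem κ B hκ hB]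

end ScalarOperator

end Summit.Ventures.CertifiedManyBodySolver.Transport

end
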